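import Literature.NumberTheory.LFunctions.KMVMollifierDiagonalMainTerm

/-!
# Route `PrimeLevelFamEdge`, crux K_B `BeyondDiagonalBeatsQuarter` (stmt-Parity-20055), line `birth`:
# the old stub S1 `stub_firstCorrectionVanishes` (corrected binder `Δ' < min Δ 2`) modulo ONE printed fact

Stub S1 of the birth skeleton of `Cruxes/BeyondDiagonalBeatsQuarter/Lines/birth.lean` said: whatever
valid off-diagonal main terms `T₁, T₂` a window `(1, Δ]` beyond the diagonal carries
(`KMV2000.MomentAsymptotics 1 Δ T₁ T₂`, the Kowalski–Michel–VanderKam mollified-moment asymptotics at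
prime level `q`, weight `2`, mollifier `M = q̂^{Δ'}`), the FIRST correction vanishes at the profile
`X²`, `Q = 1`, below length `2`. `KMV2000.LhPQ` is a concrete definition and every analytic input of
the tree is a cited fact, so S1 is a theorem MODULO printed facts; after the cell's two Literature
files (ls-Bfam-typer-1 g3: `KMVFirstMomentBeyondDiagonal` p515810, `KMVMollifierDiagonalMainTerm`
p519134 — the diagonal Möbius–ψ main term DISCHARGED from the prime number theorem for `μ`) exactly
ONE printed fact remains: Bettin 2017, Thm. 1.1 at prime level (`bettin2017_theorem11_primeLevel`:
`Σʰ_f λ_f(m) L(½,f) = m^{−1/2} + O_ε(m^{1/2} q^{−1+ε})`), which the route is to carry as the support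
item `FirstMomentPrinted` (like `PeterssonPrinted`). In the registered rev-3 skeleton (lead
ls-Bfam-prover-1 g0) S1 is proved inside the skeleton from the declared fact-stub
`stub_bettinTwistedFirstMoment` and the landed stub `stub_mollifierMainTermXSq` (p520179); this file
records the same statement on the Theorems side with the fact as its only binder (helper for the crux
item; S1 is no longer a registered stub name). No Theses statement is asserted; standard axioms only.
«The programme SEARCHES and TYPES; no claim about Landau–Siegel zeros, Theorems 1–2 of
arXiv:2211.02515 or a repaired Margin232 until a kernel theorem says so.»
-/

namespace Summit.Parity.GeneralizedHardyLittlewood.Theorems.BeyondDiagonalBeatsQuarter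

open Polynomial
open Literature.NumberTheory.LFunctions

/-- **S1 of the K_B line modulo Bettin's printed theorem only** (corrected binder `Δ' < min Δ 2`):
under `bettin2017_theorem11_primeLevel`, for every window `(1, Δ]`, every MA-consistent pair
`(T₁, T₂)` and every `1 < Δ' < min Δ 2`, `T₁ Δ' (X²) 1 = 0` — the first mollified moment at `Q = 1`
has no off-diagonal main term below length `2` (`KMV2000.firstCorrectionVanishes_of_bettin_X_sq`:
the `Q = 1` first display with zero correction from Bettin's twisted first moment and the discharged
diagonal main term, then pointwise uniqueness of the first correction along the primes).
[cite: Bettin2017, Thm. 1.1 (ν = 1)] [cite: KowalskiMichelVanderKam2000, Prop. 4.1, §6 p. 19] -/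
theorem firstCorrectionVanishes_of_bettin (hB : bettin2017_theorem11_primeLevel) :
    ∀ Δ : ℝ, 1 < Δ → ∀ T₁ T₂ : ℝ → ℝ[X] → ℝ[X] → ℝ, KMV2000.MomentAsymptotics 1 Δ T₁ T₂ →
      ∀ Δ' : ℝ, 1 < Δ' → Δ' < min Δ 2 → T₁ Δ' (X ^ 2) 1 = 0 :=
  KMV2000.firstCorrectionVanishes_of_bettin_X_sq hB

/-- The same at EVERY admissible profile `P` (`P(0) = P'(0) = 0`): `T₁ Δ' P 1 = 0` for
`1 < Δ' < min Δ 2`, modulo Bettin's printed theorem only — the `Q = 1` shape the narrowed existence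
crux K_A would need (`KMV2000.T₁_apply_one_eq_zero_of_bettin`).
[cite: Bettin2017, Thm. 1.1 (ν = 1)] [cite: KowalskiMichelVanderKam2000, Prop. 4.1, §6 p. 19] -/
theorem firstCorrectionVanishes_allProfiles_of_bettin (hB : bettin2017_theorem11_primeLevel) :
    ∀ Δ : ℝ, 1 < Δ → ∀ T₁ T₂ : ℝ → ℝ[X] → ℝ[X] → ℝ, KMV2000.MomentAsymptotics 1 Δ T₁ T₂ →
      ∀ P : ℝ[X], KMV2000.Admissible P → ∀ Δ' : ℝ, 1 < Δ' → Δ' < min Δ 2 → T₁ Δ' P 1 = 0 :=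
  fun _ _ _ _ hMA _ hP _ h1 h2 ↦ KMV2000.T₁_apply_one_eq_zero_of_bettin hB hP hMA h1 h2

end Summit.Parity.GeneralizedHardyLittlewood.Theorems.BeyondDiagonalBeatsQuarter
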